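import Summits.RiemannHypothesis.RiemannHypothesis.Theorems.JensenLogBandArcWindowQ2
import Mathlib.MeasureTheory.Integral.IntervalIntegral.FundThmCalculus
import Mathlib.Analysis.Calculus.MeanValue
import HarnessLib

/-!
# The cubic window remainder (BAND line, step S4b — CLOSED)

RH ladder column JENSEN, rung J-P(P3) «log band», BAND crux `XiDerivBandRealAllRates` of route
«JensenLogBand», line «band-one-window» (u-arc reshape), lead rh-jensen-prover g7 — step (e) of the
S4b recipe in HOME/rh-jensen-prover/g7-work/LINE-PLAN.md §8.4–8.5. RH-FREE (Γ-factor only). WHAT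
THIS IS NOT: nothing here bears on zeros of `ζ` or the truth of RH.

**`window_cubic_remainder`.** In the regime (`|x| ≤ ½`, `T ≥ 100`, `ℓ_T ≥ 20`, `n ≥ 100`,
`½ ≤ h ≤ (7/20)T`), for a zero `u*` of `S_{n,c}` in the disc (`r = ‖u*−c‖`, `φ₀ = arg(u*−c)`) and
every `ψ` with `r|ψ| ≤ h/20`:

  `‖∫_{φ₀}^{φ₀+ψ} q − ½ q′(φ₀) ψ²‖ ≤ 4n·|ψ|³`,

where `q = descentDensity n c r` is the log-derivative density of the `ζ`-free arc integrand and
`q′(φ₀) = descentDensity1 n c r φ₀ = −2w` (`descentDensity_saddle`: `Re w ≥ (11/40)n`). With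
`arcModelIntegrand_eq_mul_cexp_integral` (p490869) this is exactly the form
`I(φ₀+ψ) = I(φ₀)·exp(−wψ² + E(ψ))`, `‖E(ψ)‖ ≤ 4n|ψ|³`, consumed by `laplace_window_core` (p483889).
Proof: `q(φ₀) = 0`, `‖q″‖ ≤ 4n` on the window (`norm_descentDensity2_le`), two mean-value steps.
-/

noncomputable section

-- single-problem summit: `Summit.RiemannHypothesis.RiemannHypothesis.…` is the tree convention
set_option linter.dupNamespace false

open Complex Real Set MeasureTheory intervalIntegral

namespace Summit.RiemannHypothesis.RiemannHypothesis.Theorems.JensenPolynomials.LogBandArc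

open Literature.NumberTheory.LFunctions

variable {n : ℕ} {x T : ℝ} {ustar : ℂ}

/-- **Cubic window remainder (S4b).** See the module docstring. [folklore] -/
theorem window_cubic_remainder (hx : |x| ≤ 1 / 2) (hT : 100 ≤ T) (hℓ : 20 ≤ ell T)
    (hn : 100 ≤ n) (hh : 1 / 2 ≤ bandRadius n T) (hhT : bandRadius n T ≤ 7 / 20 * T)
    (hustar : ‖ustar - ((x : ℂ) + (T : ℂ) * I + bandRadius n T)‖ ≤ 3 / 5 * bandRadius n T)
    (hS : arcSaddleFn n ((x : ℂ) + (T : ℂ) * I) ustar = 0) {ψ : ℝ}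
    (hψ : ‖ustar - ((x : ℂ) + (T : ℂ) * I)‖ * |ψ| ≤ 1 / 20 * bandRadius n T) :
    ‖(∫ t in (Complex.arg (ustar - ((x : ℂ) + (T : ℂ) * I)))..(Complex.arg (ustar - ((x : ℂ) +
        (T : ℂ) * I)) + ψ), descentDensity n ((x : ℂ) + (T : ℂ) * I) ‖ustar - ((x : ℂ) + (T : ℂ) * I)‖ t)
      - descentDensity1 n ((x : ℂ) + (T : ℂ) * I) ‖ustar - ((x : ℂ) + (T : ℂ) * I)‖
          (Complex.arg (ustar - ((x : ℂ) + (T : ℂ) * I))) / 2 * (ψ : ℂ) ^ 2‖ ≤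
      4 * n * |ψ| ^ 3 := by
  set h := bandRadius n T with hhdef
  set c : ℂ := (x : ℂ) + (T : ℂ) * I with hc
  set w : ℂ := ustar - c with hw
  set r : ℝ := ‖w‖ with hr
  set φ₀ : ℝ := Complex.arg w with hφ₀
  set q : ℝ → ℂ := descentDensity n c r with hq
  set q1 : ℝ → ℂ := descentDensity1 n c r with hq1
  set q2 : ℝ → ℂ := descentDensity2 n c r with hq2
  have hℓ0 : 0 < ell T := by linarith
  have hh0 : 0 < h := by linarith
  obtain ⟨hre_pos, -, -, -, hr_hi⟩ := arcSaddle_polar_bounds hx hT hℓ hn hh hhT hustar hS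
  have hw0 : w ≠ 0 := by
    intro h0
    have h' : (0 : ℝ) < w.re := hre_pos
    rw [h0] at h'; simp at h'
  have hr0 : 0 < r := norm_pos_iff.2 hw0
  have hhℓ : h * ell T = 2 * ((n : ℝ) + 1) := bandRadius_mul_ell hℓ
  have hr109 : r ≤ 10 / 9 * h := by
    have h1 : r ≤ 20 / 9 * ((n : ℝ) / ell T) := hr_hi
    have h2 : (n : ℝ) / ell T ≤ h / 2 := by rw [div_le_iff₀ hℓ0]; nlinarith
    linarith
  have hstar : ‖ustar - (c + h)‖ ≤ 1 / 2 * h := norm_arcSaddle_sub_center_le_half hx hT hℓ hn hh hhT hustar hS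
  have hustar_eq : ustar = circleMap c r φ₀ := by
    rw [circleMap, hr, hφ₀, Complex.norm_mul_exp_arg_mul_I w, hw]; ring
  -- the window lies strictly inside the disc: points with r|t − φ₀| < h/10 + small
  set U : Set ℝ := {t : ℝ | ‖circleMap c r t - (c + h)‖ < 3 / 5 * h} with hU
  have hUopen : IsOpen U := isOpen_lt ((continuous_circleMap c r).sub continuous_const).norm continuous_const
  have hmemU : ∀ t : ℝ, r * |t - φ₀| ≤ 1 / 20 * h → t ∈ U := by
    intro t ht
    have := circleMap_mem_disc_of_near_saddle (ψ := t - φ₀) hstar hustar_eq hr0.le (by linarith)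
    show ‖circleMap c r t - (c + h)‖ < 3 / 5 * h
    -- sharpen: ‖u(t) − (c+h)‖ ≤ r|t−φ₀| + h/2 ≤ 11h/20
    have hdist : ‖circleMap c r (φ₀ + (t - φ₀)) - (c + h)‖ ≤ r * |t - φ₀| + 1 / 2 * h := by
      have hd : ‖circleMap c r (φ₀ + (t - φ₀)) - circleMap c r φ₀‖ ≤ r * |t - φ₀| := by
        rw [circleMap, circleMap, show c + r * cexp (↑(φ₀ + (t - φ₀)) * I) - (c + r * cexp (↑φ₀ * I)) =
          r * (cexp (↑(φ₀ + (t - φ₀)) * I) - cexp (↑φ₀ * I)) by ring, norm_mul, Complex.norm_real,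
          Real.norm_eq_abs, abs_of_nonneg hr0.le]
        refine mul_le_mul_of_nonneg_left ?_ hr0.le
        have e : cexp (↑(φ₀ + (t - φ₀)) * I) - cexp (↑φ₀ * I) =
            cexp (↑φ₀ * I) * (cexp (↑(t - φ₀) * I) - 1) := by
          rw [mul_sub, mul_one, ← Complex.exp_add]; push_cast; ring_nf
        rw [e, norm_mul, Complex.norm_exp_ofReal_mul_I, one_mul]
        have := Real.norm_exp_I_mul_ofReal_sub_one_le (x := t - φ₀)
        simpa [mul_comm] using this
      calc ‖circleMap c r (φ₀ + (t - φ₀)) - (c + h)‖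
          = ‖(circleMap c r (φ₀ + (t - φ₀)) - circleMap c r φ₀) + (ustar - (c + h))‖ := by
            rw [hustar_eq]; ring_nf
        _ ≤ ‖circleMap c r (φ₀ + (t - φ₀)) - circleMap c r φ₀‖ + ‖ustar - (c + h)‖ := norm_add_le _ _
        _ ≤ r * |t - φ₀| + 1 / 2 * h := add_le_add hd hstar
    have e2 : φ₀ + (t - φ₀) = t := by ring
    rw [e2] at hdist
    linarith
  have hwin : ∀ t ∈ uIcc φ₀ (φ₀ + ψ), r * |t - φ₀| ≤ 1 / 20 * h := by
    intro t ht
    have h1 : |t - φ₀| ≤ |ψ| := by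
      rcases le_total 0 ψ with hψ0 | hψ0
      · rw [uIcc_of_le (by linarith)] at ht
        rw [abs_of_nonneg (by linarith [ht.1]), abs_of_nonneg hψ0]; linarith [ht.2]
      · rw [uIcc_of_ge (by linarith)] at ht
        rw [abs_of_nonpos (by linarith [ht.2]), abs_of_nonpos hψ0]; linarith [ht.1]
    calc r * |t - φ₀| ≤ r * |ψ| := mul_le_mul_of_nonneg_left h1 hr0.le
      _ ≤ 1 / 20 * h := hψ
  -- derivatives of q and q1 on U, bound on q2
  have hmem_of_U : ∀ t ∈ U, ‖circleMap c r t - (c + bandRadius n T)‖ ≤ 3 / 5 * bandRadius n T :=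
    fun t ht => le_of_lt ht
  have hqd : ∀ t ∈ U, HasDerivAt q (q1 t) t := fun t ht =>
    hasDerivAt_descentDensity_eq hx hT hh hhT (hmem_of_U t ht)
  have hq1d : ∀ t ∈ U, HasDerivAt q1 (q2 t) t := fun t ht =>
    hasDerivAt_descentDensity1 hx hT hh hhT (hmem_of_U t ht)
  have hq2b : ∀ t ∈ U, ‖q2 t‖ ≤ 4 * n := fun t ht =>
    norm_descentDensity2_le hx hT hℓ hn hh hhT hr0.le hr109 (hmem_of_U t ht)
  have hφ₀U : φ₀ ∈ U := hmemU φ₀ (by simp; positivity)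
  -- q(φ₀) = 0
  have hq0 : q φ₀ = 0 := by
    show descentDensity n c r φ₀ = 0
    rw [descentDensity, ← hustar_eq, hS, mul_zero]
  -- Step A: ‖q1 t − q1 φ₀‖ ≤ 4n |t − φ₀| on the window (mean value with ‖q2‖ ≤ 4n)
  have hconvW : Convex ℝ (uIcc φ₀ (φ₀ + ψ)) := convex_uIcc _ _
  have hWU : uIcc φ₀ (φ₀ + ψ) ⊆ U := fun t ht => hmemU t (hwin t ht)
  have hA : ∀ t ∈ uIcc φ₀ (φ₀ + ψ), ‖q1 t - q1 φ₀‖ ≤ 4 * n * |t - φ₀| := by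
    intro t ht
    have := Convex.norm_image_sub_le_of_norm_hasDerivWithin_le (f := q1) (f' := q2)
      (fun s hs => (hq1d s (hWU hs)).hasDerivWithinAt) (fun s hs => hq2b s (hWU hs)) hconvW
      left_mem_uIcc ht
    rwa [Real.norm_eq_abs] at this
  -- Step B: F(t) := q t − q1 φ₀ (t − φ₀) has ‖F′‖ ≤ 4n|ψ| on the window, F(φ₀) = 0 ⇒ ‖F t‖ ≤ 4n|ψ||t−φ₀|
  set F : ℝ → ℂ := fun t => q t - q1 φ₀ * ((t : ℂ) - φ₀) with hF
  have hFd : ∀ t ∈ U, HasDerivAt F (q1 t - q1 φ₀) t := by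
    intro t ht
    have h1 : HasDerivAt (fun s : ℝ => q1 φ₀ * ((s : ℂ) - φ₀)) (q1 φ₀ * 1) t := by
      have : HasDerivAt (fun s : ℝ => ((s : ℂ) - φ₀)) 1 t := by
        simpa using (Complex.ofRealCLM.hasDerivAt (x := t)).sub_const (φ₀ : ℂ)
      exact this.const_mul _
    refine (((hqd t ht).sub h1).congr_of_eventuallyEq ?_).congr_deriv (by ring)
    exact Filter.Eventually.of_forall fun s => by simp [hF]
  have hB : ∀ t ∈ uIcc φ₀ (φ₀ + ψ), ‖F t‖ ≤ 4 * n * |ψ| * |t - φ₀| := by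
    intro t ht
    have hbound : ∀ s ∈ uIcc φ₀ (φ₀ + ψ), ‖q1 s - q1 φ₀‖ ≤ 4 * n * |ψ| := by
      intro s hs
      have h1 := hA s hs
      have h2 : |s - φ₀| ≤ |ψ| := by
        have := hwin s hs
        rcases le_total 0 ψ with hψ0 | hψ0
        · rw [uIcc_of_le (by linarith)] at hs
          rw [abs_of_nonneg (by linarith [hs.1]), abs_of_nonneg hψ0]; linarith [hs.2]
        · rw [uIcc_of_ge (by linarith)] at hs
          rw [abs_of_nonpos (by linarith [hs.2]), abs_of_nonpos hψ0]; linarith [hs.1]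
      have hn0 : (0 : ℝ) ≤ 4 * n := by positivity
      calc ‖q1 s - q1 φ₀‖ ≤ 4 * n * |s - φ₀| := h1
        _ ≤ 4 * n * |ψ| := mul_le_mul_of_nonneg_left h2 hn0
    have := Convex.norm_image_sub_le_of_norm_hasDerivWithin_le (f := F) (f' := fun s => q1 s - q1 φ₀)
      (fun s hs => (hFd s (hWU hs)).hasDerivWithinAt) hbound hconvW left_mem_uIcc ht
    have hF0 : F φ₀ = 0 := by simp [hF, hq0]
    rwa [hF0, sub_zero, Real.norm_eq_abs] at this
  -- Step C: G(t) := ∫_{φ₀}^{t} q − q1 φ₀ (t − φ₀)²/2 has G′ = F, G(φ₀) = 0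
  have hqcont : ∀ t ∈ U, ContinuousAt q t := fun t ht => (hqd t ht).continuousAt
  set G : ℝ → ℂ := fun t => (∫ s in φ₀..t, q s) - q1 φ₀ / 2 * ((t : ℂ) - φ₀) ^ 2 with hG
  have hGd : ∀ t ∈ uIcc φ₀ (φ₀ + ψ), HasDerivAt G (F t) t := by
    intro t ht
    have htU : t ∈ U := hWU ht
    have hint : IntervalIntegrable q volume φ₀ t := by
      refine ContinuousOn.intervalIntegrable ?_
      intro s hs
      exact (hqcont s (hWU (uIcc_subset_uIcc_left ht hs))).continuousWithinAt
    have hI : HasDerivAt (fun s => ∫ τ in φ₀..s, q τ) (q t) t :=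
      intervalIntegral.integral_hasDerivAt_right hint
        (ContinuousAt.stronglyMeasurableAtFilter hUopen hqcont t htU) (hqcont t htU)
    have hP : HasDerivAt (fun s : ℝ => q1 φ₀ / 2 * ((s : ℂ) - φ₀) ^ 2)
        (q1 φ₀ / 2 * (2 * ((t : ℂ) - φ₀) * 1)) t := by
      have h1 : HasDerivAt (fun s : ℝ => ((s : ℂ) - φ₀)) 1 t := by
        simpa using (Complex.ofRealCLM.hasDerivAt (x := t)).sub_const (φ₀ : ℂ)
      have h2 := h1.pow 2
      simpa using h2.const_mul (q1 φ₀ / 2)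
    have := hI.sub hP
    refine this.congr_deriv ?_
    simp only [hF]
    ring
  have hB' : ∀ t ∈ uIcc φ₀ (φ₀ + ψ), ‖F t‖ ≤ 4 * n * |ψ| ^ 2 := by
    intro t ht
    have h1 := hB t ht
    have h2 : |t - φ₀| ≤ |ψ| := by
      rcases le_total 0 ψ with hψ0 | hψ0
      · rw [uIcc_of_le (by linarith)] at ht
        rw [abs_of_nonneg (by linarith [ht.1]), abs_of_nonneg hψ0]; linarith [ht.2]
      · rw [uIcc_of_ge (by linarith)] at ht
        rw [abs_of_nonpos (by linarith [ht.2]), abs_of_nonpos hψ0]; linarith [ht.1]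
    have hn0 : (0 : ℝ) ≤ 4 * n * |ψ| := by positivity
    calc ‖F t‖ ≤ 4 * n * |ψ| * |t - φ₀| := h1
      _ ≤ 4 * n * |ψ| * |ψ| := mul_le_mul_of_nonneg_left h2 hn0
      _ = 4 * n * |ψ| ^ 2 := by ring
  have hC := Convex.norm_image_sub_le_of_norm_hasDerivWithin_le (f := G) (f' := F)
    (fun s hs => (hGd s hs).hasDerivWithinAt) hB' hconvW left_mem_uIcc right_mem_uIcc
  have hG0 : G φ₀ = 0 := by simp [hG, intervalIntegral.integral_same]
  rw [hG0, sub_zero, show φ₀ + ψ - φ₀ = ψ by ring, Real.norm_eq_abs] at hC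
  have hGψ : G (φ₀ + ψ) = (∫ t in φ₀..φ₀ + ψ, q t) - q1 φ₀ / 2 * (ψ : ℂ) ^ 2 := by
    simp only [hG]; push_cast; ring
  rw [hGψ] at hC
  calc ‖(∫ t in φ₀..φ₀ + ψ, q t) - q1 φ₀ / 2 * (ψ : ℂ) ^ 2‖ ≤ 4 * n * |ψ| ^ 2 * |ψ| := hC
    _ = 4 * n * |ψ| ^ 3 := by ring

end Summit.RiemannHypothesis.RiemannHypothesis.Theorems.JensenPolynomials.LogBandArc

end
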